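import Summits.Langlands.Langlands.Theses.RationalPeriodQuarter
import Summits.Langlands.Langlands.Theorems.RationalPeriodQuarterEigencharacter
import Summits.Langlands.Langlands.Theorems.RationalPeriodQuarterHeckeTransportAlg

/-!
# `HeckeTransportQuarter` — child B of the split of `HeckeFieldOfCruxes` (stmt-Langlands-10432)

    RationalPeriodClassesQuarter → HeckePreservesRationalPeriods →
      (ℚ-independent rational-period quarter-forms are ℂ-independent) → HeckeFieldQuarter

(Assembly steps (1), (3)–(5) of route `RationalPeriodQuarter`, stmt-2813.) Given `(N, χ, u, a)` as in
`HeckeFieldQuarter`: `u` is `Γ₁(N)`-invariant (nebentypus `χ(d)`, `d ≡ 1 (N)`), hence a quarter cusp form;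
spanning gives `u ∈ span_ℂ S_ℚ(N)`; for `p ∤ N` prime the operator
`L_p v := (√p)⁻¹ (Σ_(b<p) v((z+b)/p) + v(σ_p • (p z)))` with `σ_p := (gcdA p N, -gcdB p N; N, p) ∈ Γ₀(N)`
preserves `S_ℚ(N)` (Hecke stability) and has `L_p u = a_p u` (nebentypus: `u(σ_p • (pz)) = χ(p) u(pz)`); the
abstract transport lemma `heckeField_of_transport` (Theorems.RationalPeriodQuarterHeckeTransportAlg) fed
with the PROVED descending-chain lemma `rationalEigencharacterLemma` (stmt-2809) gives the number field.
-/

set_option linter.dupNamespace false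

namespace Summit.Langlands.Langlands.Theorems

open scoped BigOperators Topology Matrix
open Filter Set
open Summit.Langlands.Langlands.Theses.RationalPeriodQuarter

/-- Child B `HeckeTransportQuarter` of the node `HeckeFieldOfCruxesSplit` (interface inlined verbatim). -/
theorem heckeTransportQuarter_statement :
    RationalPeriodClassesQuarter → HeckePreservesRationalPeriods → (let slashHalf : Matrix.SpecialLinearGroup (Fin 2) ℤ → (ℝ → ℂ) → ℝ → ℂ := fun g φ t => ((|((g : Matrix (Fin 2) (Fin 2) ℤ) 1 0 : ℝ) * t + ((g : Matrix (Fin 2) (Fin 2) ℤ) 1 1 : ℝ)|⁻¹ : ℝ) : ℂ) * φ ((((g : Matrix (Fin 2) (Fin 2) ℤ) 0 0 : ℝ) * t + ((g : Matrix (Fin 2) (Fin 2) ℤ) 0 1 : ℝ)) / (((g : Matrix (Fin 2) (Fin 2) ℤ) 1 0 : ℝ) * t + ((g : Matrix (Fin 2) (Fin 2) ℤ) 1 1 : ℝ))); let IsQuarterCuspForm : ℕ → (UpperHalfPlane → ℂ) → Prop := fun N u => Literature.NumberTheory.Automorphic.IsC2 u ∧ (∀ γ ∈ CongruenceSubgroup.Gamma1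 N, ∀ z : UpperHalfPlane, u (γ • z) = u z) ∧ (∀ z : UpperHalfPlane, Literature.NumberTheory.Automorphic.hypLaplacian u z + (1 / 4 : ℂ) * u z = 0) ∧ ∃ C : ℝ, ∀ z : UpperHalfPlane, ‖u z‖ ≤ C; let lzCocycle : (UpperHalfPlane → ℂ) → Matrix.SpecialLinearGroup (Fin 2) ℤ → ℝ → ℂ := fun u γ t => ∫ τ in (0 : ℝ)..1, (let w : ℂ := (1 - (τ : ℂ)) * ((γ⁻¹ • UpperHalfPlane.I : UpperHalfPlane) : ℂ) + (τ : ℂ) * Complex.I; let dw : ℂ := Complex.I - ((γ⁻¹ • UpperHalfPlane.I : UpperHalfPlane) : ℂ); (fderiv ℝ (u ∘ UpperHalfPlane.ofComplex) w 1 - Complex.I * fderiv ℝ (u ∘ UpperHalfPlane.ofComplex) w Complex.I) / 2 * ((Real.sqrt w.im / ‖w - (t : ℂ)‖ : ℝ) : ℂ) * dw + (u ∘ UpperHalfPlane.ofComplex) w * (((fderiv ℝ (fun x : ℂ => Real.sqrt x.im / ‖x - (t : ℂ)‖) w 1 : ℝ) + Complex.I * (fderiv ℝ (fun x : ℂ =>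 Real.sqrt x.im / ‖x - (t : ℂ)‖) w Complex.I : ℝ)) / 2) * (starRingEnd ℂ) dw); let IsPRQ : (ℝ → ℂ) → Prop := fun φ => ∃ F : Finset ℚ, (∀ a b : ℚ, a < b → (∀ r ∈ F, r ≤ a ∨ b ≤ r) → ∃ P Q : Polynomial ℚ, ∀ x : ℝ, (a : ℝ) < x → x < b → Polynomial.aeval (x : ℂ) Q ≠ 0 ∧ φ x = Polynomial.aeval (x : ℂ) P / Polynomial.aeval (x : ℂ) Q) ∧ ∃ B : ℚ, (∃ P Q : Polynomial ℚ, ∀ x : ℝ, (B : ℝ) < x → Polynomial.aeval (x : ℂ) Q ≠ 0 ∧ φ x = Polynomial.aeval (x : ℂ) P / Polynomial.aeval (x : ℂ) Q) ∧ (∃ P Q : Polynomial ℚ, ∀ x : ℝ, x < -(B : ℝ) → Polynomial.aeval (x : ℂ) Q ≠ 0 ∧ φ x = Polynomial.aeval (x : ℂ) P / Polynomial.aeval (x : ℂ) Q); let IsSemiAnalytic : (ℝ → ℂ) → Prop := fun f => ∃ F : Finset ℝ, AnalyticOnNhd ℝ f ((↑F : Set ℝ)ᶜ); let HasRationalPeriodClass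 : ℕ → (UpperHalfPlane → ℂ) → Prop := fun N u => ∃ (q : Matrix.SpecialLinearGroup (Fin 2) ℤ → ℝ → ℂ) (f : ℝ → ℂ), (∀ γ ∈ CongruenceSubgroup.Gamma1 N, IsPRQ (q γ)) ∧ (∀ γ ∈ CongruenceSubgroup.Gamma1 N, ∀ δ ∈ CongruenceSubgroup.Gamma1 N, ∀ᶠ t in Filter.cofinite, q (γ * δ) t = slashHalf δ (q γ) t + q δ t) ∧ IsSemiAnalytic f ∧ ∀ γ ∈ CongruenceSubgroup.Gamma1 N, ∀ᶠ t in Filter.cofinite, lzCocycle u γ t = q γ t + slashHalf γ f t - f t; ∀ N : ℕ, 0 < N → ∀ (m : ℕ) (v : Fin m → UpperHalfPlane → ℂ), (∀ j, IsQuarterCuspForm N (v j) ∧ HasRationalPeriodClass N (v j)) → LinearIndependent ℚ v → LinearIndependent ℂ v) → HeckeFieldQuarter := by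
  intro h₁ h₄ hI N hN χ u hC2 hneb hlap hbdd hne a hT
  classical
  let slashHalf : Matrix.SpecialLinearGroup (Fin 2) ℤ → (ℝ → ℂ) → ℝ → ℂ := fun g φ t => ((|((g : Matrix (Fin 2) (Fin 2) ℤ) 1 0 : ℝ) * t + ((g : Matrix (Fin 2) (Fin 2) ℤ) 1 1 : ℝ)|⁻¹ : ℝ) : ℂ) * φ ((((g : Matrix (Fin 2) (Fin 2) ℤ) 0 0 : ℝ) * t + ((g : Matrix (Fin 2) (Fin 2) ℤ) 0 1 : ℝ)) / (((g : Matrix (Fin 2) (Fin 2) ℤ) 1 0 : ℝ) * t + ((g : Matrix (Fin 2) (Fin 2) ℤ) 1 1 : ℝ)))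
  let IsQuarterCuspForm : ℕ → (UpperHalfPlane → ℂ) → Prop := fun N u => Literature.NumberTheory.Automorphic.IsC2 u ∧ (∀ γ ∈ CongruenceSubgroup.Gamma1 N, ∀ z : UpperHalfPlane, u (γ • z) = u z) ∧ (∀ z : UpperHalfPlane, Literature.NumberTheory.Automorphic.hypLaplacian u z + (1 / 4 : ℂ) * u z = 0) ∧ ∃ C : ℝ, ∀ z : UpperHalfPlane, ‖u z‖ ≤ C
  let lzCocycle : (UpperHalfPlane → ℂ) → Matrix.SpecialLinearGroup (Fin 2) ℤ → ℝ → ℂ := fun u γ t => ∫ τ in (0 : ℝ)..1, (let w : ℂ := (1 - (τ : ℂ)) * ((γ⁻¹ • UpperHalfPlane.I : UpperHalfPlane) : ℂ) + (τ : ℂ) * Complex.I; let dw : ℂ := Complex.I - ((γ⁻¹ • UpperHalfPlane.I : UpperHalfPlane) : ℂ); (fderiv ℝ (u ∘ UpperHalfPlane.ofComplex) w 1 - Complex.I * fderiv ℝ (u ∘ UpperHalfPlane.ofComplex) w Complex.I) / 2 * ((Real.sqrt w.im / ‖w - (t : ℂ)‖ : ℝ) : ℂ) * dw + (u ∘ UpperHalfPlane.ofComplex)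 w * (((fderiv ℝ (fun x : ℂ => Real.sqrt x.im / ‖x - (t : ℂ)‖) w 1 : ℝ) + Complex.I * (fderiv ℝ (fun x : ℂ => Real.sqrt x.im / ‖x - (t : ℂ)‖) w Complex.I : ℝ)) / 2) * (starRingEnd ℂ) dw)
  let IsPRQ : (ℝ → ℂ) → Prop := fun φ => ∃ F : Finset ℚ, (∀ a b : ℚ, a < b → (∀ r ∈ F, r ≤ a ∨ b ≤ r) → ∃ P Q : Polynomial ℚ, ∀ x : ℝ, (a : ℝ) < x → x < b → Polynomial.aeval (x : ℂ) Q ≠ 0 ∧ φ x = Polynomial.aeval (x : ℂ) P / Polynomial.aeval (x : ℂ) Q) ∧ ∃ B : ℚ, (∃ P Q : Polynomial ℚ, ∀ x : ℝ, (B : ℝ) < x → Polynomial.aeval (x : ℂ) Q ≠ 0 ∧ φ x = Polynomial.aeval (x : ℂ) P / Polynomial.aeval (x : ℂ) Q) ∧ (∃ P Q : Polynomial ℚ, ∀ x : ℝ, x < -(B : ℝ) → Polynomial.aeval (x : ℂ) Q ≠ 0 ∧ φ x = Polynomial.aeval (x : ℂ) P / Polynomial.aeval (x : ℂ) Q)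
  let IsSemiAnalytic : (ℝ → ℂ) → Prop := fun f => ∃ F : Finset ℝ, AnalyticOnNhd ℝ f ((↑F : Set ℝ)ᶜ)
  let HasRationalPeriodClass : ℕ → (UpperHalfPlane → ℂ) → Prop := fun N u => ∃ (q : Matrix.SpecialLinearGroup (Fin 2) ℤ → ℝ → ℂ) (f : ℝ → ℂ), (∀ γ ∈ CongruenceSubgroup.Gamma1 N, IsPRQ (q γ)) ∧ (∀ γ ∈ CongruenceSubgroup.Gamma1 N, ∀ δ ∈ CongruenceSubgroup.Gamma1 N, ∀ᶠ t in Filter.cofinite, q (γ * δ) t = slashHalf δ (q γ) t + q δ t) ∧ IsSemiAnalytic f ∧ ∀ γ ∈ CongruenceSubgroup.Gamma1 N, ∀ᶠ t in Filter.cofinite, lzCocycle u γ t = q γ t + slashHalf γ f t - f t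
  -- the `ℚ`-form as a set of functions
  let S : Set (UpperHalfPlane → ℂ) := fun v => IsQuarterCuspForm N v ∧ HasRationalPeriodClass N v
  -- (1) `u` is a quarter cusp form on `Γ₁(N)`
  have hΓ1 : ∀ γ ∈ CongruenceSubgroup.Gamma1 N, ∀ z : UpperHalfPlane, u (γ • z) = u z := by
    intro γ hγ z
    have hγ' := (CongruenceSubgroup.Gamma1_mem N γ).1 hγ
    have hγ0 : γ ∈ CongruenceSubgroup.Gamma0 N := CongruenceSubgroup.Gamma0_mem.2 hγ'.2.2
    have h := hneb γ hγ0 z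
    rw [hγ'.2.1, map_one, one_mul] at h
    exact h
  have huS : IsQuarterCuspForm N u := ⟨hC2, hΓ1, hlap, hbdd⟩
  -- (2) spanning: `u ∈ span_ℂ S`, `u ≠ 0`
  obtain ⟨m, v, c, hv, huv⟩ := h₁ N hN u huS
  have hu_span : u ∈ Submodule.span ℂ S := by
    have hu_eq : u = ∑ i, c i • v i := by
      funext z
      simp only [huv z, Finset.sum_apply, Pi.smul_apply, smul_eq_mul]
    rw [hu_eq]
    exact Submodule.sum_mem _ fun i _ => Submodule.smul_mem _ _ (Submodule.subset_span (hv i))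
  have hu0 : u ≠ 0 := by
    obtain ⟨z, hz⟩ := hne
    intro h
    exact hz (by simp [h])
  -- (3) the operators `L_p`, `p ∤ N` prime
  let ιN : Type := {p : ℕ // p.Prime ∧ ¬ p ∣ N}
  have hσex : ∀ p : ιN, ∃ σ : Matrix.SpecialLinearGroup (Fin 2) ℤ, σ ∈ CongruenceSubgroup.Gamma0 N ∧
      ((((σ : Matrix (Fin 2) (Fin 2) ℤ) 1 1 : ℤ) : ZMod N)) = ((p.1 : ℕ) : ZMod N) := by
    rintro ⟨p, hp, hpN⟩
    have hcop : Nat.gcd p N = 1 := ((Nat.Prime.coprime_iff_not_dvd hp).2 hpN)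
    have hbez : ((Nat.gcd p N : ℕ) : ℤ) = (p : ℤ) * Nat.gcdA p N + (N : ℤ) * Nat.gcdB p N :=
      Nat.gcd_eq_gcd_ab p N
    rw [hcop] at hbez
    push_cast at hbez
    refine ⟨⟨!![Nat.gcdA p N, -Nat.gcdB p N; (N : ℤ), (p : ℤ)], ?_⟩, ?_, ?_⟩
    · rw [Matrix.det_fin_two_of]
      linear_combination -hbez
    · rw [CongruenceSubgroup.Gamma0_mem]
      simp
    · simp
  choose σ hσ0 hσ11 using hσex
  let L : ιN → (UpperHalfPlane → ℂ) →ₗ[ℂ] (UpperHalfPlane → ℂ) := fun p =>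
    { toFun := fun (w : UpperHalfPlane → ℂ) (z : UpperHalfPlane) => ((Real.sqrt p.1 : ℝ) : ℂ)⁻¹ *
          (∑ b ∈ Finset.range p.1, w (UpperHalfPlane.ofComplex (((z : ℂ) + b) / p.1)) +
            w (σ p • UpperHalfPlane.ofComplex ((p.1 : ℂ) * (z : ℂ))))
      map_add' := fun w₁ w₂ => by
        funext z
        simp only [Pi.add_apply, Finset.sum_add_distrib]
        ring
      map_smul' := fun r w => by
        funext z
        simp only [Pi.smul_apply, smul_eq_mul, RingHom.id_apply, ← Finset.mul_sum]
        ring }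
  have hLS : ∀ p : ιN, ∀ s ∈ S, L p s ∈ S := by
    intro p s hs
    exact h₄ N hN p.1 p.2.1 p.2.2 (σ p) (hσ0 p) (hσ11 p) s hs.1 hs.2
  -- (4) the independence interface for `S`
  have hind : ∀ (k : ℕ) (w : Fin k → UpperHalfPlane → ℂ), (∀ j, w j ∈ S) →
      LinearIndependent ℚ w → LinearIndependent ℂ w :=
    fun k w hw hQ => hI N hN k w (fun j => hw j) hQ
  -- (5) eigen-equations `L_p u = a_p u`
  have heig : ∀ p : ιN, L p u = a p.1 • u := by
    rintro p
    obtain ⟨hp, hpN⟩ := p.2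
    funext z
    have hTz := hT p.1 hp hpN z
    have hnebz : u (σ p • UpperHalfPlane.ofComplex ((p.1 : ℂ) * (z : ℂ))) =
        χ ((p.1 : ℕ) : ZMod N) * u (UpperHalfPlane.ofComplex ((p.1 : ℂ) * (z : ℂ))) := by
      rw [hneb (σ p) (hσ0 p), hσ11 p]
    have hsq : ((Real.sqrt p.1 : ℝ) : ℂ) ≠ 0 :=
      Complex.ofReal_ne_zero.2 (Real.sqrt_ne_zero'.2 (Nat.cast_pos.2 hp.pos))
    simp only [L, LinearMap.coe_mk, AddHom.coe_mk, Pi.smul_apply, smul_eq_mul]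
    rw [hnebz, hTz]
    field_simp
  -- (6) transport
  obtain ⟨E, hE, haE⟩ := heckeField_of_transport
    (RationalPeriodQuarterEigencharacter.rationalEigencharacterLemma) S L hLS hind u hu_span hu0
    (fun p : ιN => a p.1) heig
  exact ⟨E, hE, fun p hp hpN => haE ⟨p, hp, hpN⟩⟩

end Summit.Langlands.Langlands.Theorems
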